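import Literature.AnabelianGeometry.SemiGraphs.OncePuncturedTemperedGroupWitness
import Literature.AnabelianGeometry.SemiGraphs.TemperedProfiniteProducts
import Literature.AnabelianGeometry.AbsoluteAnabelian.MLFSlimKummerProofs
import Literature.NumberTheory.GaloisRepresentations.LocalFieldCountableExtensions
import Literature.NumberTheory.GaloisRepresentations.LocalFieldPadicProofs
import Mathlib.Topology.Algebra.ClopenNhdofOne
import HarnessLib

/-!
# A kernel inhabitant of `OncePuncturedTemperedGroup ℚ_p` with GENUINE geometric part AND genuine
# arithmetic quotient `G_{ℚ_p}` ([EtTh] §1 pp. 237–239 / [SemiAnbd] Ex. 3.10)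

Mochizuki, *The étale theta function …*, Publ. RIMS **45** (2009) [EtTh], §1, PRIMS pp. 237–239;
*Semi-graphs of anabelioids*, Publ. RIMS **42** (2006) [SemiAnbd], Example 3.10 pp. 43–45. abc-iut cell,
wave-5 prover seat abc-iut-w5-d218 (gen 2); VACUITY LANE, sequel of `OncePuncturedTemperedGroupWitness`
(base field algebraically closed) and `TemperedArithmeticGroupPadicWitness` (`G_{ℚ_p}` Galois-countable,
slim; imported there — here the second-countability of `G_{ℚ_p}` is re-derived inline so that this file
depends only on built modules). PROOF-ONLY (no definition, no instance, no named fact).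

MODEL over `K = ℚ_p`: `Π := Γ × G_{ℚ_p}` with `Γ = F̂₂ ×_{Ẑ} ℤ` the tempered slim group of parts A–C and
`G_{ℚ_p} = Gal(Q̄_p/ℚ_p)`; augmentation `pr₂` (onto `G_{ℚ_p}`, kernel `Γ × 1 ≅ Γ`); `Π ↠ ℤ` the
`ℤ`-quotient of `Γ` (open kernel); `Π̂ := F̂₂ × G_{ℚ_p}`, `toHat := pr₁ × id` — an injective
`IsProfiniteCompletion` (abc-iut-w5-d240's `IsProfiniteCompletion.prodMap_id` over part B); `augHat := pr₂`
with kernel `F̂₂ × 1 =` the closure of the image of `Δ = Γ × 1`, profinite free on two generators; cusp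
family `{1 × G_{ℚ_p}}` (closed, normal, inside `Ker(Π ↠ ℤ)`, mapping ONTO `G_{ℚ_p}`).  All three
printed exact sequences are thus realised non-trivially; what remains DEGENERATE (honest label): `Π` is a
PRODUCT (the extension `1 → Δ → Π → G_K → 1` splits and `G_K` acts trivially on `Δ`), and the cusp
family is a single normal subgroup — this is not the tempered fundamental group of a curve.
Tools proved here: `isSlimGroup_prod` (products of slim groups are slim),
`isSlimGroup_of_continuousMulEquiv` (transport). Consumed BY NAME: parts A–D (abc-iut-w5-d218),
`IsTempered.prod_of_profinite` / `IsProfiniteCompletion.prodMap_id` (abc-iut-w5-d240,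
`TemperedProfiniteProducts`), `galoisMLF_slim_holds` (abc-iut-L4), `toCompletion_int_injective` (w5-d114).
HONEST FRAMING: consistency evidence only; nothing of [EtTh]/[SemiAnbd] is asserted; no side is taken on
[IUTchIII] Cor. 3.12.
-/

noncomputable section

open Topology TopologicalSpace Filter Set Function CategoryTheory
open Literature.IUT.HodgeTheaters (profiniteCompletion toCompletion toCompletion_int_injective)
open Literature.AlgebraicGeometry.Frobenioids (IsSlimGroup)

universe u v

namespace Literature.AnabelianGeometry.SemiGraphs

/-! ### Slimness: products and transport -/

/-- **A product of slim groups is slim**: an open `U ≤ A × B` contains the slices `U ∩ (A × 1)` and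
`U ∩ (1 × B)`, whose traces `{a | (a,1) ∈ U}`, `{b | (1,b) ∈ U}` are open in `A`, `B`; an element
centralising `U` centralises both traces componentwise. [cite: MochizukiSemiAnbd2006, Ex 3.10 p.45] -/
theorem isSlimGroup_prod {A : Type u} {B : Type v} [Group A] [TopologicalSpace A] [Group B]
    [TopologicalSpace B] (hA : IsSlimGroup A) (hB : IsSlimGroup B) : IsSlimGroup (A × B) := by
  refine ⟨fun U hU => ?_⟩
  let U₁ : Subgroup A := U.comap (MonoidHom.inl A B)
  let U₂ : Subgroup B := U.comap (MonoidHom.inr A B)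
  have hU₁ : IsOpen (U₁ : Set A) := hU.preimage (continuous_id.prodMk continuous_const)
  have hU₂ : IsOpen (U₂ : Set B) := hU.preimage (continuous_const.prodMk continuous_id)
  have h₁ := hA.centralizer_eq_bot U₁ hU₁
  have h₂ := hB.centralizer_eq_bot U₂ hU₂
  refine (Subgroup.eq_bot_iff_forall _).mpr fun c hc => ?_
  obtain ⟨a, b⟩ := c
  have ha : a ∈ Subgroup.centralizer (U₁ : Set A) := by
    rw [Subgroup.mem_centralizer_iff]
    intro x hx
    have := Subgroup.mem_centralizer_iff.mp hc (x, 1) hx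
    simpa using congrArg Prod.fst this
  have hb : b ∈ Subgroup.centralizer (U₂ : Set B) := by
    rw [Subgroup.mem_centralizer_iff]
    intro y hy
    have := Subgroup.mem_centralizer_iff.mp hc (1, y) hy
    simpa using congrArg Prod.snd this
  rw [h₁] at ha; rw [h₂] at hb
  rw [Subgroup.mem_bot.mp ha, Subgroup.mem_bot.mp hb]; rfl

/-- **Slimness is invariant under topological isomorphisms.** [cite: MochizukiSemiAnbd2006, Ex 3.10 p.45] -/
theorem isSlimGroup_of_continuousMulEquiv {A : Type u} {B : Type v} [Group A] [TopologicalSpace A]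
    [Group B] [TopologicalSpace B] (e : A ≃ₜ* B) (hA : IsSlimGroup A) : IsSlimGroup B := by
  refine ⟨fun U hU => ?_⟩
  let U' : Subgroup A := U.comap e.toMulEquiv.toMonoidHom
  have hU' : IsOpen (U' : Set A) := hU.preimage e.continuous_toFun
  have h := hA.centralizer_eq_bot U' hU'
  refine (Subgroup.eq_bot_iff_forall _).mpr fun c hc => ?_
  have hc' : e.symm c ∈ Subgroup.centralizer (U' : Set A) := by
    rw [Subgroup.mem_centralizer_iff]
    intro x hx
    have hx' : e x ∈ U := hx
    have := Subgroup.mem_centralizer_iff.mp hc (e x) hx'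
    apply e.injective
    simpa [map_mul] using this
  rw [h] at hc'
  have : e.symm c = 1 := Subgroup.mem_bot.mp hc'
  simpa using congrArg e this

/-! ### The inhabitant over `ℚ_p` -/

/-- **Kernel inhabitant of `OncePuncturedTemperedGroup ℚ_p`**: `Π := (F̂₂ ×_{Ẑ} ℤ) × G_{ℚ_p}` (tempered,
slim, Galois-countable), augmentation `pr₂` onto the GENUINE `G_{ℚ_p}` with kernel `≅ F̂₂ ×_{Ẑ} ℤ`
(tempered, slim), `Π ↠ ℤ` with open kernel, `Π̂ := F̂₂ × G_{ℚ_p}` an injective `IsProfiniteCompletion`,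
`Ker(Π̂ → G_{ℚ_p}) = F̂₂ × 1` profinite free on two generators, cusp family `{1 × G_{ℚ_p}}`.  DEGENERATE
aspects (honest label): split extension with trivial outer action; a single normal cusp group.
Consistency evidence for the axiom package of the L3 interface; not `π₁^temp` of a curve.
[cite: MochizukiEtTh2009, §1 pp.237-239] -/
theorem OncePuncturedTemperedGroup.nonempty_model_padic (p : ℕ) [Fact p.Prime] :
    Nonempty (OncePuncturedTemperedGroup ℚ_[p]) := by
  classical
  -- ##### the geometric part `Γ = F̂₂ ×_Ẑ ℤ` (as in `OncePuncturedTemperedGroupWitness`)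
  let P : ProfiniteGrp.{0} := profiniteCompletion (FreeGroup (Fin 2))
  let Zh : ProfiniteGrp.{0} := profiniteCompletion (Multiplicative ℤ)
  let η : FreeGroup (Fin 2) →* P := toCompletion (FreeGroup (Fin 2))
  let ι : Multiplicative ℤ →* Zh := toCompletion (Multiplicative ℤ)
  let a : FreeGroup (Fin 2) := FreeGroup.of 0
  let b : FreeGroup (Fin 2) := FreeGroup.of 1
  let σa : FreeGroup (Fin 2) →* Multiplicative ℤ :=
    FreeGroup.lift fun j => if j = (0 : Fin 2) then Multiplicative.ofAdd (1 : ℤ) else 1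
  let σb : FreeGroup (Fin 2) →* Multiplicative ℤ :=
    FreeGroup.lift fun j => if j = (1 : Fin 2) then Multiplicative.ofAdd (1 : ℤ) else 1
  have hσaa : σa a = Multiplicative.ofAdd 1 := by simp [σa, a]
  have hσab : σa b = 1 := by simp [σa, b]
  have hσba : σb a = 1 := by simp [σb, a]
  have hσbb : σb b = Multiplicative.ofAdd 1 := by simp [σb, b]
  let e : P →ₜ* Zh := (ProfiniteGrp.ProfiniteCompletion.lift (GrpCat.ofHom (ι.comp σa))).hom
  let êb : P →ₜ* Zh := (ProfiniteGrp.ProfiniteCompletion.lift (GrpCat.ofHom (ι.comp σb))).hom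
  let îa : Zh →ₜ* P :=
    (ProfiniteGrp.ProfiniteCompletion.lift (GrpCat.ofHom (η.comp (zpowersHom _ a)))).hom
  let îb : Zh →ₜ* P :=
    (ProfiniteGrp.ProfiniteCompletion.lift (GrpCat.ofHom (η.comp (zpowersHom _ b)))).hom
  have he : ∀ g, e (η g) = ι (σa g) := fun g => lift_hom_toCompletion Zh (ι.comp σa) g
  have hêb : ∀ g, êb (η g) = ι (σb g) := fun g => lift_hom_toCompletion Zh (ι.comp σb) g
  have hîa : ∀ k : ℤ, îa (ι (Multiplicative.ofAdd k)) = η (a ^ k) := fun k => by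
    rw [lift_hom_toCompletion P (η.comp (zpowersHom _ a))]; simp [zpowersHom_apply]
  have hîb : ∀ k : ℤ, îb (ι (Multiplicative.ofAdd k)) = η (b ^ k) := fun k => by
    rw [lift_hom_toCompletion P (η.comp (zpowersHom _ b))]; simp [zpowersHom_apply]
  have hιinj : Injective ι := toCompletion_int_injective
  let Γ : Subgroup (P × Multiplicative ℤ) :=
    (e.toMonoidHom.comp (MonoidHom.fst P (Multiplicative ℤ))).eqLocus
      (ι.comp (MonoidHom.snd P (Multiplicative ℤ)))
  have hΓ : ∀ q : P × Multiplicative ℤ, q ∈ Γ ↔ e q.1 = ι q.2 := fun q => Iff.rfl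
  have hηd : DenseRange η := ProfiniteGrp.ProfiniteCompletion.denseRange (GrpCat.of (FreeGroup (Fin 2)))
  have hηN : ∀ N : Subgroup (FreeGroup (Fin 2)), N.Normal → N.FiniteIndex →
      ∃ V : OpenNormalSubgroup P, ∀ g, η g ∈ V ↔ g ∈ N :=
    fun N _ _ => exists_openNormal_eta_mem_iff N
  have hs : Surjective σa := fun n => ⟨a ^ n.toAdd, by
    rw [map_zpow, hσaa, ← ofAdd_zsmul, smul_eq_mul, mul_one]; rfl⟩
  have hZ : ∀ A : Subgroup (Multiplicative ℤ), A.FiniteIndex →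
      ∀ k : Multiplicative ℤ, ι k ∈ closure (ι '' (A : Set (Multiplicative ℤ))) → k ∈ A :=
    fun A hA k hk => by haveI := hA; exact mem_of_toCompletion_mem_closure A k hk
  haveI hscP : SecondCountableTopology P := secondCountableTopology_profiniteCompletion_freeGroup (Fin 2)
  have hTΓ : IsTempered Γ := TemperedFibreProduct.isTempered e ι Γ hΓ
  have hSlimΓ : IsSlimGroup Γ :=
    TemperedFibreProduct.isSlimGroup e êb îa îb σa σb hσaa hσab hσba hσbb he hêb hîa hîb hιinj Γ hΓ
  haveI : SecondCountableTopology Γ := TemperedFibreProduct.secondCountableTopology Γ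
  let zQuotΓ : Γ →* Multiplicative ℤ := (MonoidHom.snd P (Multiplicative ℤ)).comp Γ.subtype
  let prΓ : Γ →ₜ* P := ⟨(MonoidHom.fst P (Multiplicative ℤ)).comp Γ.subtype,
    continuous_fst.comp continuous_subtype_val⟩
  have hPC : IsProfiniteCompletion prΓ :=
    TemperedFibreProduct.isProfiniteCompletion_fst e ι Γ hΓ η hηd hηN σa hs he hZ prΓ fun _ => rfl
  -- ##### the arithmetic part `G = G_{ℚ_p}`
  haveI : IsGalois ℚ_[p] (AlgebraicClosure ℚ_[p]) := {}
  haveI : CompactSpace (Field.absoluteGaloisGroup ℚ_[p]) := by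
    change CompactSpace (AlgebraicClosure ℚ_[p] ≃ₐ[ℚ_[p]] AlgebraicClosure ℚ_[p]); infer_instance
  haveI : T2Space (Field.absoluteGaloisGroup ℚ_[p]) := krullTopology_t2
  haveI : TotallyDisconnectedSpace (Field.absoluteGaloisGroup ℚ_[p]) := by
    change TotallyDisconnectedSpace (AlgebraicClosure ℚ_[p] ≃ₐ[ℚ_[p]] AlgebraicClosure ℚ_[p])
    infer_instance
  -- `G_{ℚ_p}` is Galois-countable (second countable): countably many open subgroups (tree, Krasner) and
  -- the cosets of the open normal subgroups form a basis (re-derived inline; cf. the companion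
  -- `TemperedArithmeticGroupPadicWitness.secondCountableTopology_absoluteGaloisGroup_padic`)
  haveI : SecondCountableTopology (Field.absoluteGaloisGroup ℚ_[p]) := by
    haveI := Literature.NumberTheory.GaloisRepresentations.Padic.isValuativeTopology p
    haveI : IsNonarchimedeanLocalField ℚ_[p] := {}
    haveI : Countable (OpenSubgroup (Field.absoluteGaloisGroup ℚ_[p])) :=
      Literature.NumberTheory.GaloisRepresentations.countable_openSubgroup_of_isNonarchimedeanLocalField ℚ_[p]
    let B : Set (Set (Field.absoluteGaloisGroup ℚ_[p])) :=
      ⋃ U : OpenSubgroup (Field.absoluteGaloisGroup ℚ_[p]),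
        Set.range fun q : Field.absoluteGaloisGroup ℚ_[p] ⧸ U.toSubgroup =>
          (QuotientGroup.mk ⁻¹' {q} : Set (Field.absoluteGaloisGroup ℚ_[p]))
    have hBc : B.Countable := by
      refine Set.countable_iUnion fun U => ?_
      haveI : Finite (Field.absoluteGaloisGroup ℚ_[p] ⧸ U.toSubgroup) := inferInstance
      exact (Set.finite_range _).countable
    have hBopen : ∀ s ∈ B, IsOpen s := by
      intro s hs
      obtain ⟨U, hU⟩ := Set.mem_iUnion.mp hs
      obtain ⟨q, rfl⟩ := hU
      exact (isOpen_discrete {q}).preimage (QuotientGroup.continuous_mk (N := U.toSubgroup))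
    have hB : IsTopologicalBasis B := by
      refine isTopologicalBasis_of_isOpen_of_nhds hBopen ?_
      intro x O hxO hO
      have hO' : IsOpen ((fun y : Field.absoluteGaloisGroup ℚ_[p] => x * y) ⁻¹' O) :=
        hO.preimage (continuous_const.mul continuous_id)
      obtain ⟨V, hV⟩ :=
        ProfiniteGrp.exist_openNormalSubgroup_sub_open_nhds_of_one hO' (by simpa using hxO)
      refine ⟨QuotientGroup.mk ⁻¹' {(QuotientGroup.mk x : Field.absoluteGaloisGroup ℚ_[p] ⧸ V.toSubgroup)},
        ?_, rfl, ?_⟩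
      · exact Set.mem_iUnion.mpr ⟨V.toOpenSubgroup, ⟨_, rfl⟩⟩
      · intro y hy
        have hy' : (QuotientGroup.mk y : Field.absoluteGaloisGroup ℚ_[p] ⧸ V.toSubgroup) =
            QuotientGroup.mk x := hy
        have hxy : x⁻¹ * y ∈ V.toSubgroup := QuotientGroup.eq.mp hy'.symm
        have := hV hxy
        simpa using this
    exact hB.secondCountableTopology hBc
  have hSlimG : IsSlimGroup (Field.absoluteGaloisGroup ℚ_[p]) :=
    Literature.AnabelianGeometry.AbsoluteAnabelian.galoisMLF_slim_holds p ℚ_[p]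
  -- ##### the product `Π := Γ × G`
  let aug : (Γ × Field.absoluteGaloisGroup ℚ_[p]) →ₜ* Field.absoluteGaloisGroup ℚ_[p] :=
    ContinuousMonoidHom.snd _ _
  have haug_mem : ∀ x : Γ × Field.absoluteGaloisGroup ℚ_[p], x ∈ aug.toMonoidHom.ker ↔ x.2 = 1 :=
    fun x => MonoidHom.mem_ker
  have hkerClosed : IsClosed (aug.toMonoidHom.ker : Set (Γ × Field.absoluteGaloisGroup ℚ_[p])) := by
    rw [MonoidHom.coe_ker]; exact isClosed_singleton.preimage (map_continuous aug)
  -- `Ker aug = Γ × 1 ≃ₜ* Γ`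
  let eKer : Γ ≃ₜ* aug.toMonoidHom.ker :=
    { toFun := fun γ => ⟨(γ, 1), (haug_mem _).mpr rfl⟩
      invFun := fun x => x.1.1
      left_inv := fun _ => rfl
      right_inv := fun x => by
        obtain ⟨⟨γ, g⟩, hx⟩ := x
        have hg : g = 1 := (haug_mem _).mp hx
        subst hg; rfl
      map_mul' := fun _ _ => rfl
      continuous_toFun := (continuous_id.prodMk continuous_const).subtype_mk _
      continuous_invFun := continuous_fst.comp continuous_subtype_val }
  have hT : IsTempered (Γ × Field.absoluteGaloisGroup ℚ_[p]) := hTΓ.prod_of_profinite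
  -- `toHat := prΓ × id`
  let toHat : (Γ × Field.absoluteGaloisGroup ℚ_[p]) →ₜ* (P × Field.absoluteGaloisGroup ℚ_[p]) :=
    prΓ.prodMap (ContinuousMonoidHom.id _)
  have htoHat : ∀ x : Γ × Field.absoluteGaloisGroup ℚ_[p],
      toHat x = ((x.1 : P × Multiplicative ℤ).1, x.2) := fun _ => rfl
  have hPC' : IsProfiniteCompletion toHat := hPC.prodMap_id
  let augHat : (P × Field.absoluteGaloisGroup ℚ_[p]) →ₜ* Field.absoluteGaloisGroup ℚ_[p] :=
    ContinuousMonoidHom.snd _ _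
  -- `Ker augHat = P × 1 = closure of toHat(Ker aug)`
  have hmemP1 : ∀ y : P, ((y, (1 : Field.absoluteGaloisGroup ℚ_[p])) : P × _) ∈
      ((aug.toMonoidHom.ker).map toHat.toMonoidHom).topologicalClosure := by
    intro y
    -- `(y,1)` is in the closure of `{(pr₁ q, 1)}` since `pr₁` has dense range
    have hsub : (fun z : P => ((z, (1 : Field.absoluteGaloisGroup ℚ_[p])) : P × _)) '' Set.range prΓ ⊆
        (((aug.toMonoidHom.ker).map toHat.toMonoidHom : Subgroup _) : Set _) := by
      rintro _ ⟨_, ⟨q, rfl⟩, rfl⟩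
      exact ⟨(q, 1), (haug_mem _).mpr rfl, rfl⟩
    have hcl : ((y, (1 : Field.absoluteGaloisGroup ℚ_[p])) : P × _) ∈
        closure ((fun z : P => ((z, (1 : Field.absoluteGaloisGroup ℚ_[p])) : P × _)) '' Set.range prΓ) := by
      have hy : y ∈ closure (Set.range prΓ) := by
        rw [hPC.denseRange.closure_range]; exact Set.mem_univ _
      exact image_closure_subset_closure_image (continuous_id.prodMk continuous_const) ⟨y, hy, rfl⟩
    exact closure_mono hsub hcl
  have hkerHat : augHat.toMonoidHom.ker = ((aug.toMonoidHom.ker).map toHat.toMonoidHom).topologicalClosure := by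
    refine le_antisymm ?_ ?_
    · rintro ⟨y, g⟩ hyg
      have hg : g = 1 := hyg
      subst hg
      exact hmemP1 y
    · refine Subgroup.topologicalClosure_minimal _ ?_ ?_
      · rintro _ ⟨x, hx, rfl⟩
        have hx2 : x.2 = 1 := (haug_mem x).mp hx
        change (toHat x).2 = 1
        rw [htoHat]; exact hx2
      · rw [MonoidHom.coe_ker]; exact isClosed_singleton.preimage (map_continuous augHat)
  -- `Δ̂ = P × 1 ≃ₜ* P = F̂₂` is profinite free on two generators
  have hfree : ∃ x : Fin 2 → ((aug.toMonoidHom.ker).map toHat.toMonoidHom).topologicalClosure,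
      IsFreeProfiniteOn _ x := by
    let S := ((aug.toMonoidHom.ker).map toHat.toMonoidHom).topologicalClosure
    have hS2 : ∀ z : S, (z : P × Field.absoluteGaloisGroup ℚ_[p]).2 = 1 := fun z => by
      have hz : (z : P × _) ∈ augHat.toMonoidHom.ker := by rw [hkerHat]; exact z.2
      exact hz
    let eS : P ≃ₜ* S :=
      { toFun := fun y => ⟨(y, 1), hmemP1 y⟩
        invFun := fun z => (z : P × Field.absoluteGaloisGroup ℚ_[p]).1
        left_inv := fun _ => rfl
        right_inv := fun z => Subtype.ext (Prod.ext rfl (hS2 z).symm)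
        map_mul' := fun _ _ => rfl
        continuous_toFun := (continuous_id.prodMk continuous_const).subtype_mk _
        continuous_invFun := continuous_fst.comp continuous_subtype_val }
    exact ⟨_, (isFreeProfiniteOn_profiniteCompletion_freeGroup (Fin 2)).of_continuousMulEquiv eS⟩
  -- the cusp group `1 × G`
  let D : Subgroup (Γ × Field.absoluteGaloisGroup ℚ_[p]) := (⊥ : Subgroup Γ).prod ⊤
  haveI hDn : D.Normal := Subgroup.prod_normal ⊥ ⊤
  refine ⟨{
    Pi := Γ × Field.absoluteGaloisGroup ℚ_[p]
    isTempered := hT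
    aug := aug
    aug_surjective := fun g => ⟨(1, g), rfl⟩
    isTempered_ker := hT.subgroup_of_isClosed _ hkerClosed
    isSlimGroup := isSlimGroup_prod hSlimΓ hSlimG
    isSlimGroup_ker := isSlimGroup_of_continuousMulEquiv eKer hSlimΓ
    secondCountableTopology := inferInstance
    zQuot := zQuotΓ.comp (MonoidHom.fst Γ (Field.absoluteGaloisGroup ℚ_[p]))
    zQuot_surjective := (TemperedFibreProduct.snd_surjective_of e ι Γ hΓ
      (TemperedFibreProduct.exists_apply_eq_iota e ι η σa hs he)).comp Prod.fst_surjective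
    isOpen_ker_zQuot := by
      have : (((zQuotΓ.comp (MonoidHom.fst Γ (Field.absoluteGaloisGroup ℚ_[p]))).ker :
          Subgroup (Γ × _)) : Set (Γ × Field.absoluteGaloisGroup ℚ_[p])) =
          Prod.fst ⁻¹' (zQuotΓ.ker : Set Γ) := by
        ext x; simp [MonoidHom.mem_ker]
      rw [this]
      exact (TemperedFibreProduct.isOpen_ker_snd Γ).preimage continuous_fst
    PiHat := P × Field.absoluteGaloisGroup ℚ_[p]
    toHat := toHat
    isProfiniteCompletion_toHat := hPC'
    toHat_injective := (TemperedFibreProduct.fst_injective e ι Γ hΓ hιinj).prodMap injective_id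
    augHat := augHat
    augHat_comp_toHat := fun _ => rfl
    ker_augHat := hkerHat
    deltaHat_free := hfree
    cuspDecomp := {D}
    cuspDecomp_nonempty := ⟨D, rfl⟩
    isClosed_of_mem_cuspDecomp := fun D' hD' => by
      rw [Set.mem_singleton_iff.mp hD', Subgroup.coe_prod, Subgroup.coe_bot, Subgroup.coe_top]
      exact isClosed_singleton.prod isClosed_univ
    le_ker_of_mem_cuspDecomp := fun D' hD' => by
      rw [Set.mem_singleton_iff.mp hD']
      rintro ⟨γ, g⟩ hx
      have hγ : γ = 1 := (Subgroup.mem_prod.mp hx).1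
      subst hγ
      simp [MonoidHom.mem_ker]
    conj_mem_cuspDecomp := fun D' hD' x => by
      rw [Set.mem_singleton_iff.mp hD', Set.mem_singleton_iff]
      exact Subgroup.Normal.map_conj_eq D x
    map_aug_eq_top_of_mem_cuspDecomp := fun D' hD' => by
      rw [Set.mem_singleton_iff.mp hD']
      refine eq_top_iff.mpr fun g _ => ⟨(1, g), Subgroup.mem_prod.mpr ⟨Subgroup.mem_bot.mpr rfl,
        Subgroup.mem_top g⟩, rfl⟩ }⟩

end Literature.AnabelianGeometry.SemiGraphs

end
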